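import Literature.NumberTheory.EllipticCurves.HasseWeilAbelianCoinvariantsProofs
import Literature.NumberTheory.EllipticCurves.InertiaInvariantsAdditiveProofs
import HarnessLib

/-!
# The additive-place fact of `HasseWeilAbelianBadReduction` is a theorem:
# `(V_ℓ E)_{I_𝔓} = 0` at a place `v ∤ ℓ` of additive reduction

Topic `NumberTheory/EllipticCurves`; sibling proof file (theorems only, D-0014 append protocol:
nothing is defined, no named fact is introduced) of `HasseWeilAbelianBadReduction`.  It discharges
the third of its three named facts,
`WeierstrassCurve.inertiaCoinvariants_rationalTate_eq_zero_of_hasAdditiveReductionAt W ℓ` — *for an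
elliptic curve `E/K` over a number field, a prime `ℓ`, a finite place `v ∤ ℓ` of additive
reduction and a prime `𝔓 ∣ v` of `\bar ℤ_K`, the inertia coinvariants of the rational Tate module
vanish: `dim_{ℚ_ℓ} (V_ℓ E)_{I_𝔓} = 0`* — by assembling two theorems of the tree, exactly along the
argument recorded in the docstring of the fact:

* **invariants** (Silverman, *Advanced Topics in the Arithmetic of Elliptic Curves*, §IV.10,
  Definition of the tame part of the conductor, `ε(E/K) = 2 - dim_{ℚ_ℓ} V_ℓ(E)^{I(K̄/K)}`, and
  Thm. 10.2(a), *`ε(E/K) = 2` if `E` has additive reduction*, PDF p. 358; proof p. 359: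
  `V_ℓ(E)^{I} ≅ V_ℓ(Ẽ_ns(k̄)) = V_ℓ(k̄⁺) = 0`): the named fact
  `codimFixed_inertia_rationalTate_eq_two_of_hasAdditiveReductionAt W ℓ` of
  `HasseWeilAbelianConductor`, a theorem of the tree
  (`codimFixed_inertia_rationalTate_eq_two_of_hasAdditiveReductionAt_holds`,
  `InertiaInvariantsAdditiveProofs`, through the Kodaira–Néron finiteness over `K_v^nr`);
* **from invariants to coinvariants** (`dim (V_ℓ E)_{I_𝔓} = dim (V_ℓ E)^{I_𝔓}`, because `I_𝔓`
  acts on the plane `V_ℓ E` with determinant `1`: `det ρ_{E,ℓ} = χ_ℓ` by the Weil pairing,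
  Silverman, *AEC*, Prop. III.8.1, III.8.3, unramified at `v ∤ ℓ`):
  `inertiaCoinvariants_rationalTate_eq_zero_of_hasAdditiveReductionAt_of_codim`
  (`HasseWeilAbelianCoinvariantsProofs`).

(The fact file itself cannot host the discharge: both inputs import it.)

## Main result

* `WeierstrassCurve.inertiaCoinvariants_rationalTate_eq_zero_of_hasAdditiveReductionAt_holds`.

## References

* J. H. Silverman, *Advanced Topics in the Arithmetic of Elliptic Curves*, GTM 151 (1994), §IV.10,
  Definition (tame part of the conductor) and Thm. 10.2(a) with its proof (PDF pp. 358–359).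
  [SilvermanATAEC1994]
* J. H. Silverman, *The Arithmetic of Elliptic Curves*, 2nd ed., GTM 106 (2009), Prop. III.8.1,
  III.8.3 (Weil pairing, `det ρ_ℓ = χ_ℓ`), §C.16 (PDF p. 390). [SilvermanAEC2009]

## Design

One theorem, a one-line assembly; `noncomputable section`; universe `u` (`K : Type u`) and the
variable layout of the sibling files (dot-notation extension of Mathlib's `WeierstrassCurve`).
-/

noncomputable section

universe u

namespace WeierstrassCurve

variable {K : Type u} [Field K] [NumberField K] (W : WeierstrassCurve K) (ℓ : ℕ) [Fact ℓ.Prime]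

/-- **Additive reduction: `(V_ℓ E)_{I_𝔓} = 0` — the named fact
`inertiaCoinvariants_rationalTate_eq_zero_of_hasAdditiveReductionAt W ℓ` of
`HasseWeilAbelianBadReduction` is a theorem.**  For an elliptic curve `E/K` over a number field, a
prime `ℓ`, a place `v ∤ ℓ` of additive reduction and `𝔓 ∣ v`, `dim_{ℚ_ℓ} (V_ℓ E)_{I_𝔓} = 0`:
Silverman *ATAEC* Thm. IV.10.2(a), additive case (`ε(E/K) = 2 - dim V_ℓ(E)^{I} = 2`, i.e. the
inertia invariants vanish; the tree's
`codimFixed_inertia_rationalTate_eq_two_of_hasAdditiveReductionAt_holds`), transported to the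
coinvariants by `dim (V_ℓ E)_{I} = dim (V_ℓ E)^{I}` (inertia acts on the plane `V_ℓ E` with
determinant `1`, Weil pairing, *AEC* III.8.1/III.8.3; the tree's
`inertiaCoinvariants_rationalTate_eq_zero_of_hasAdditiveReductionAt_of_codim`).
[cite: SilvermanATAEC1994, §IV.10 Definition and Thm. 10.2(a) with its proof (PDF pp. 358–359)]
[cite: SilvermanAEC2009, Prop. III.8.1 and Prop. III.8.3] -/
theorem inertiaCoinvariants_rationalTate_eq_zero_of_hasAdditiveReductionAt_holds :
    W.inertiaCoinvariants_rationalTate_eq_zero_of_hasAdditiveReductionAt ℓ :=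
  W.inertiaCoinvariants_rationalTate_eq_zero_of_hasAdditiveReductionAt_of_codim ℓ
    (W.codimFixed_inertia_rationalTate_eq_two_of_hasAdditiveReductionAt_holds ℓ)

end WeierstrassCurve

end
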